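/-
Copyright (c) 2026 the pub-hodgecm-mathlib formalisation cell (harness21).  Prover seat hodgecm-mathlib-K2E3-p12 (g3), Track B «K2-LIT» ∕ h413
(`stmt-HodgeConjecture-24833`), line `K2_E3_EllipticInputs`, unit U12-d, row 12: the Lie-algebra core (L-A_GL) «local character expansion at `1` in
`T̂`-form» FOR FINITE-DIMENSIONAL REPRESENTATIONS OF `GL_N(F)` (every `N`: `T = dim π · δ₀`), and (L-A_GL) OUTRIGHT IN RANK `N = 1`.  2026-09-04.
-/
import Summits.HodgeConjecture.HodgeConjecture.Theorems.K2E3NormalizedCharBddNearSemisimpleFinDim   -- ★ p855804 (K2E3-p12 g2): `apply_eq_trace_of_finite`; brings ★ `isLocallyConstant_trace`, `integral_indicator_one_mul_eq_of_eqOn`, `exists_isCompact_isOpen_subgroup_subset`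
import Summits.HodgeConjecture.HodgeConjecture.Theorems.K2E3GLnNilpotentFourierPointSupport       -- ★ p856457 (K2E3-p12 g3): `matrixFourier_apply_zero`
import Summits.HodgeConjecture.HodgeConjecture.Theorems.K2E3CayleyCharpolyDiscr                   -- ★ p855189 (K2E3-p12 g0): `discr_charpoly_cayley_mul_det_pow`
import Literature.NumberTheory.Automorphic.GLnConstantTermTestFunctions                            -- ★ `nonarchimedeanGroup_gl` (`GL_N(F)` is non-archimedean)
import Literature.NumberTheory.Automorphic.LocalPiSchwartzBruhatFourier                            -- ★ boxes `piPrimePowBall`, `exists_piPrimePowBall_subset_of_mem_nhds_zero`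
import Summits.HodgeConjecture.HodgeConjecture.Theorems.K2E3GLTwoRamifiedShellStabilizers          -- ★ `glOne_mul_comm` (`GL₁(F)` is commutative)
import Mathlib.Topology.Instances.Matrix
import HarnessLib

/-!
# K2_E3 road (h413), unit U12-d — (L-A_GL) «local character expansion at `1`» for FINITE-DIMENSIONAL `π`, every `N`; (L-A_GL) in rank `1`

Cell `pub/hodgecm-mathlib` (D-0151), Track B (21-frontier RULING «PUSH BOTH» 2026-09-03, director req624), seat K2E3-p12 (g3), lineage of row 12.
`--supports stmt-HodgeConjecture-24833 --as helper`; THEOREMS ONLY (no definition ∕ instance ∕ notation ∕ named fact ∕ `sorry`); never imports `Cruxes/…/Lines`.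

The Lie-algebra core (L-A_GL) (`subsig_K2E3GLnLieCharExpansionAtOne` of SUBSIGS v3, = hypothesis `hAGL` of ★ `normalizedCharBddOnCayleySlice_of_lieCore'`) is
Harish-Chandra's local character expansion at `γ = 1` in `T̂`-form [HarishChandra1999, Thm. 16.2∕16.3 p. 77, §21 p. 87; Howe1974 Prop. 3]: near `1`,
`Θ_π(c(Y)) = F_T(Y)` for a `T ∈ J(𝒩)` and any locally-constant representative `F_T` of `T̂`.  For a FINITE-DIMENSIONAL smooth irreducible `π` of `GL_N(F)` the
expansion is TRIVIAL and EXACT: `Θ_π` is the locally constant function `g ↦ tr π(g)` (★ `apply_eq_trace_of_finite`), equal to `dim π` near `1`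
(★ `isLocallyConstant_trace`), so `T := dim π · δ₀` (`c₀ = dim π`, all other `c_𝒪 = 0`) does it: `T̂ = dim π` and every locally constant `F_T` representing `T̂`
equals `dim π` at each of its points of local constancy (Haar measure charges compact open boxes).  In rank `N = 1` EVERY admissible irreducible `π` is
finite-dimensional (`GL₁(F)` is commutative: `V^K` is a non-zero subrepresentation for a small compact open `K`), so (L-A_GL) holds there verbatim.
* §1 `cayley_mem_nhds_one` — pull-back of neighbourhoods of `1 ∈ GL_N(F)` along the Cayley map: for `W ∈ 𝓝 1` there is `V ∈ 𝓝 (0 : M_N(F))` with `g ∈ W`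
  whenever `g = (1+Y)(1−Y)⁻¹`, `Y ∈ V`, `1 ± Y` invertible (units topology = embedding `g ↦ (g, g⁻¹)`; `g⁻¹ = (1−Y)(1+Y)⁻¹`).
* §2 `apply_eq_of_repr_fourier_pointSupport` — if `dim·𝓕f(0) = ∫ f·F dμ𝔤` for every `f ∈ C_c^∞(𝔤𝔩_N(F))` and `F` is locally constant at `Y`, then `F(Y) = dim`
  (test against the indicator of a small compact open box around `Y`).
* §3 **`lieCharExpansionAtOne_of_finite`** — the CONCLUSION of (L-A_GL) for every finite-dimensional smooth irreducible `π` of `GL_N(F)`, every `N`, every `ψ`, every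
  Haar `μ𝔤`, `μ₀` (`F` of characteristic `0`), with `T = dim π · δ₀`.
* §4 `finite_of_isAdmissible_gl_one` (★ `glOne_mul_comm`) + **`gl1_lieCharExpansionAtOne`** — (L-A_GL) `subsig_K2E3GLnLieCharExpansionAtOne` VERBATIM with `N := 1` (all hypotheses kept);
  with ★ p856457 `gl1_nilpotentFourierRegular` BOTH `GL`-cores are now ★ in rank `1`.
[HarishChandra1999AdmissibleDistributions, Thm. 16.2–16.3 p. 77, §21 p. 87] [Howe1974, Prop. 3] [BushnellHenniart2006, §1.1, §2.6] [GetzHahn2024, §8.5 (8.15)].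
HONEST LABEL: HC_CM is proved only modulo the 7 printed citations (2 remaining named inputs: hLiu418 = stmt-HodgeConjecture-24832, h413 =
stmt-HodgeConjecture-24833) until rung 0 closes; count-neutral helper (the hosted socket quantifies every `N` and every admissible `π`).

## References
* [HarishChandra1999AdmissibleDistributions] Harish-Chandra (DeBacker–Sally), *Admissible Invariant Distributions on Reductive p-adic Groups* (1999), Thm. 16.2, 16.3, §21.
* [Howe1974] R. Howe, *The Fourier transform and germs of characters (case of GL_n over a p-adic field)*, Math. Ann. 208 (1974), Prop. 3.
* [BushnellHenniart2006] C. J. Bushnell, G. Henniart, *The local Langlands conjecture for GL(2)* (2006), §1.1, §2.6.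
* [GetzHahn2024] J. Getz, H. Hahn, *An Introduction to Automorphic Representations* (2024), §8.5 (8.15).
-/

set_option autoImplicit false
set_option linter.dupNamespace false   -- `Summit.HodgeConjecture.HodgeConjecture.…` (D-0017 nested layout; lakefile exemption for Summits)

noncomputable section

open MeasureTheory Measure Filter Topology Polynomial
open scoped Matrix MatrixGroups NNReal Pointwise
open Literature.NumberTheory.Rogawski1990 Literature.NumberTheory.Automorphic
open Literature.NumberTheory.GaloisRepresentations Literature.NumberTheory.GaloisRepresentations.IsNonarchimedeanLocalField
open Summit.HodgeConjecture.HodgeConjecture.Cruxes.H413.K2E3CharLocIntNearSemisimpleFinDim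
open Summit.HodgeConjecture.HodgeConjecture.Cruxes.H413.K2E3CharLocBddOfLocal
open Summit.HodgeConjecture.HodgeConjecture.Cruxes.H413.K2E3NormalizedCharBddNearSemisimpleRegular
open Summit.HodgeConjecture.HodgeConjecture.Cruxes.H413.K2E3NormalizedCharBddNearSemisimpleFinDim
open Summit.HodgeConjecture.HodgeConjecture.Cruxes.H413.K2E3GLnNilpotentFourierPointSupport
open Summit.HodgeConjecture.HodgeConjecture.Cruxes.H413.K2E3CayleyCharpolyDiscr

namespace Summit.HodgeConjecture.HodgeConjecture.Cruxes.H413.K2E3GLnLieCharExpansionAtOneFinDim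

variable {F : Type*} [Field F] [ValuativeRel F] [TopologicalSpace F] [IsNonarchimedeanLocalField F] {N : ℕ}

/-! ## §1  Neighbourhoods of `1 ∈ GL_N(F)` pulled back along the Cayley map -/

/-- **Pull-back of a neighbourhood of `1 ∈ GL_N(F)` along the Cayley map**: for `W ∈ 𝓝 1` there is `V ∈ 𝓝 (0 : M_N(F))` such that every `g ∈ GL_N(F)` with
`g = (1+Y)(1−Y)⁻¹`, `Y ∈ V`, `1 ± Y` invertible, lies in `W`.  (The topology of `GL_N = M_N^×` is induced by `g ↦ (g, g⁻¹)`, and `g⁻¹ = (1−Y)(1+Y)⁻¹`; both are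
continuous in `Y` at `0`.) [cite: PlatonovRapinchuk1994, §3.3] -/
theorem cayley_mem_nhds_one {W : Set (GL (Fin N) F)} (hW : W ∈ 𝓝 (1 : GL (Fin N) F)) :
    ∃ V : Set (Matrix (Fin N) (Fin N) F), V ∈ 𝓝 (0 : Matrix (Fin N) (Fin N) F) ∧ ∀ g : GL (Fin N) F, ∀ Y ∈ V,
      IsUnit (1 - Y) → IsUnit (1 + Y) → (g : Matrix (Fin N) (Fin N) F) = (1 + Y) * (1 - Y)⁻¹ → g ∈ W := by
  -- the units topology is induced by `embedProduct : g ↦ (g, op g⁻¹)`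
  rw [Units.isInducing_embedProduct.nhds_eq_comap, Filter.mem_comap] at hW
  obtain ⟨S, hS, hSW⟩ := hW
  rw [Units.embedProduct_apply, Units.val_one, inv_one, Units.val_one, MulOpposite.op_one, mem_nhds_prod_iff] at hS
  obtain ⟨U₁, hU₁, U₂, hU₂, hUS⟩ := hS
  -- continuity at `0` of the Cayley map and of its inverse companion
  have hinv1 : ContinuousAt Inv.inv (1 : Matrix (Fin N) (Fin N) F) := by
    refine continuousAt_matrix_inv _ ?_
    rw [Matrix.det_one, Ring.inverse_eq_inv']
    exact continuousAt_inv₀ one_ne_zero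
  have hsub : ContinuousAt (fun Y : Matrix (Fin N) (Fin N) F => (1 - Y)⁻¹) 0 := by
    have h2 : ContinuousAt (fun Y : Matrix (Fin N) (Fin N) F => 1 - Y) 0 := continuousAt_const.sub continuousAt_id
    have h1 : ContinuousAt Inv.inv ((fun Y : Matrix (Fin N) (Fin N) F => 1 - Y) 0) := by simpa only [sub_zero] using hinv1
    exact ContinuousAt.comp (g := Inv.inv) (f := fun Y : Matrix (Fin N) (Fin N) F => 1 - Y) h1 h2
  have hadd : ContinuousAt (fun Y : Matrix (Fin N) (Fin N) F => (1 + Y)⁻¹) 0 := by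
    have h2 : ContinuousAt (fun Y : Matrix (Fin N) (Fin N) F => 1 + Y) 0 := continuousAt_const.add continuousAt_id
    have h1 : ContinuousAt Inv.inv ((fun Y : Matrix (Fin N) (Fin N) F => 1 + Y) 0) := by simpa only [add_zero] using hinv1
    exact ContinuousAt.comp (g := Inv.inv) (f := fun Y : Matrix (Fin N) (Fin N) F => 1 + Y) h1 h2
  have hc1 : ContinuousAt (fun Y : Matrix (Fin N) (Fin N) F => (1 + Y) * (1 - Y)⁻¹) 0 :=
    (continuousAt_const.add continuousAt_id).mul hsub
  have hc2 : ContinuousAt (fun Y : Matrix (Fin N) (Fin N) F => MulOpposite.op ((1 - Y) * (1 + Y)⁻¹)) 0 :=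
    MulOpposite.continuous_op.continuousAt.comp ((continuousAt_const.sub continuousAt_id).mul hadd)
  refine ⟨(fun Y : Matrix (Fin N) (Fin N) F => (1 + Y) * (1 - Y)⁻¹) ⁻¹' U₁ ∩ (fun Y => MulOpposite.op ((1 - Y) * (1 + Y)⁻¹)) ⁻¹' U₂,
    Filter.inter_mem (hc1.preimage_mem_nhds (by simpa using hU₁)) (hc2.preimage_mem_nhds (by simpa using hU₂)), ?_⟩
  intro g Y hY h1 h2 hg
  have hinv' : ((g⁻¹ : GL (Fin N) F) : Matrix (Fin N) (Fin N) F) = (1 - Y) * (1 + Y)⁻¹ := by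
    refine Units.inv_eq_of_mul_eq_one_right ?_
    rw [hg, Matrix.mul_assoc, ← Matrix.mul_assoc ((1 - Y)⁻¹), Matrix.nonsing_inv_mul _ ((Matrix.isUnit_iff_isUnit_det _).1 h1), Matrix.one_mul,
      Matrix.mul_nonsing_inv _ ((Matrix.isUnit_iff_isUnit_det _).1 h2)]
  refine hSW ?_
  rw [Set.mem_preimage, Units.embedProduct_apply, hinv', hg]
  exact hUS ⟨hY.1, hY.2⟩

/-! ## §2  A locally constant representative of the constant distribution `dim · (f ↦ ∫ f)` takes the value `dim` -/

/-- A compact open box around `Y` inside a given neighbourhood: `∃ S` compact, open, `Y ∈ S ⊆ O` (boxes `Y + (𝔭^k)^{N×N}`, ★ `exists_piPrimePowBall_subset_of_mem_nhds_zero`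
through the coordinate homeomorphism `M_N(F) ≃ F^{N×N}`). [cite: WeilBNT1967, Ch. II §2] -/
theorem exists_isCompact_isOpen_mem_subset (Y : Matrix (Fin N) (Fin N) F) {O : Set (Matrix (Fin N) (Fin N) F)} (hO : O ∈ 𝓝 Y) :
    ∃ S : Set (Matrix (Fin N) (Fin N) F), IsCompact S ∧ IsOpen S ∧ Y ∈ S ∧ S ⊆ O := by
  classical
  let e : Matrix (Fin N) (Fin N) F ≃ₜ (Fin N × Fin N → F) :=
    { toFun := fun X p => X p.1 p.2
      invFun := fun x => Matrix.of fun i j => x (i, j)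
      left_inv := fun X => by ext i j; rfl
      right_inv := fun x => by funext p; rfl
      continuous_toFun := continuous_pi fun p => continuous_id.matrix_elem p.1 p.2
      continuous_invFun := continuous_matrix fun i j => continuous_apply (i, j) }
  have he0 : e.symm 0 = 0 := rfl
  have he0' : e 0 = 0 := rfl
  have hW : {z : Fin N × Fin N → F | Y + e.symm z ∈ O} ∈ 𝓝 (0 : Fin N × Fin N → F) := by
    have hc : ContinuousAt (fun z : Fin N × Fin N → F => Y + e.symm z) 0 := (continuousAt_const.add e.symm.continuous.continuousAt)
    refine hc.preimage_mem_nhds ?_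
    show O ∈ 𝓝 (Y + e.symm 0)
    rw [he0, add_zero]
    exact hO
  obtain ⟨k, hk⟩ := exists_piPrimePowBall_subset_of_mem_nhds_zero hW
  refine ⟨(fun X => e (X - Y)) ⁻¹' piPrimePowBall F (Fin N × Fin N) k, ?_, (isOpen_piPrimePowBall _).preimage (e.continuous.comp (continuous_id.sub continuous_const)),
    ?_, fun X hX => ?_⟩
  · have hset : (fun X => e (X - Y)) ⁻¹' piPrimePowBall F (Fin N × Fin N) k = (fun z => Y + e.symm z) '' piPrimePowBall F (Fin N × Fin N) k := by
      ext X
      constructor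
      · intro hX
        exact ⟨e (X - Y), hX, by simp⟩
      · rintro ⟨z, hz, rfl⟩
        simpa using hz
    rw [hset]
    exact (isCompact_piPrimePowBall _).image (continuous_const.add e.symm.continuous)
  · rw [Set.mem_preimage, sub_self, he0']
    exact zero_mem_piPrimePowBall _
  · have h := hk hX
    simpa using h

/-- **A locally constant representative of the constant distribution is the constant**: if `d · ∫ ψ(tr(0·X)) f(X) dμ𝔤 = ∫ f·Fn dμ𝔤` for every `f ∈ C_c^∞(𝔤𝔩_N(F))` (i.e.
`T̂ = Fn` as distributions for `T = d·δ₀`) and `Fn` is locally constant at `Y`, then `Fn(Y) = d` — test against `1_S` for a compact open box `S ∋ Y` on which `Fn` is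
constant (`0 < μ𝔤(S) < ∞`). [cite: HarishChandra1999AdmissibleDistributions, Thm. 4.4 p. 11] -/
theorem apply_eq_of_repr_fourier_pointSupport (ψ : AddChar F Circle) [MeasurableSpace (Matrix (Fin N) (Fin N) F)] [BorelSpace (Matrix (Fin N) (Fin N) F)]
    (μ𝔤 : Measure (Matrix (Fin N) (Fin N) F)) [μ𝔤.IsAddHaarMeasure] (d : ℂ) (Fn : Matrix (Fin N) (Fin N) F → ℂ)
    (hFn : ∀ f : Matrix (Fin N) (Fin N) F → ℂ, IsLocSmooth f →
      d * (∫ X, ((ψ (Matrix.trace ((0 : Matrix (Fin N) (Fin N) F) * X)) : Circle) : ℂ) * f X ∂μ𝔤) = ∫ X, f X * Fn X ∂μ𝔤)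
    {Y : Matrix (Fin N) (Fin N) F} (hY : ∀ᶠ Z in 𝓝 Y, Fn Z = Fn Y) : Fn Y = d := by
  haveI : T2Space F := (isLocalField F).toT2Space
  obtain ⟨S, hSc, hSo, hYS, hSO⟩ := exists_isCompact_isOpen_mem_subset Y hY
  have hφ : IsLocSmooth (S.indicator fun _ => (1 : ℂ)) := isLocSmooth_indicator hSo hSc.isClosed hSc
  have h := hFn _ hφ
  rw [matrixFourier_apply_zero, integral_indicator_const _ hSo.measurableSet, Complex.real_smul, mul_one] at h
  have h2 : ∫ X, S.indicator (fun _ => (1 : ℂ)) X * Fn X ∂μ𝔤 = (μ𝔤.real S : ℂ) * Fn Y :=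
    integral_indicator_one_mul_eq_of_eqOn μ𝔤 hSo.measurableSet Fn (Fn Y) fun X hX => hSO hX
  have h3 : (μ𝔤.real S : ℂ) ≠ 0 := by
    rw [Complex.ofReal_ne_zero, measureReal_def]
    exact (ENNReal.toReal_pos ((hSo.measure_pos μ𝔤 ⟨Y, hYS⟩).ne') hSc.measure_lt_top.ne).ne'
  rw [h2] at h
  exact mul_left_cancel₀ h3 (h.symm.trans (mul_comm _ _))

/-! ## §3  (L-A_GL) for finite-dimensional `π`, every `N` -/

set_option maxHeartbeats 1600000 in
/-- **(L-A_GL) «local character expansion at `1` in `T̂`-form» for a FINITE-DIMENSIONAL smooth irreducible `π` of `GL_N(F)`** (every `N`, `F` of characteristic `0`,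
any `ψ`, any Haar measures; conclusion of `subsig_K2E3GLnLieCharExpansionAtOne` token for token): with `T := dim π · δ₀ ∈ J(𝒩)` (`c₀ = dim π`, `c_𝒪 = 0` for
`𝒪 ≠ {0}`), for every `F_T` representing `T̂` and locally constant at the regular points, `Θ_π(c(Y)) = F_T(Y)` for regular `Y` near `0` — both sides equal `dim π`:
`Θ_π = tr π` (★ `apply_eq_trace_of_finite`) is `≡ dim π` near `1` (★ `isLocallyConstant_trace`, pulled back along the Cayley map by §1), `F_T ≡ dim π` at its
regular points (§2), and `c(Y)` is regular when `Y` is (★ `discr_charpoly_cayley_mul_det_pow`).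
[cite: HarishChandra1999AdmissibleDistributions, Thm. 16.2–16.3 p. 77, §21 p. 87] [cite: Howe1974, Prop. 3] [cite: BushnellHenniart2006, §1.1] -/
theorem lieCharExpansionAtOne_of_finite [CharZero F] (ψ : AddChar F Circle)
    [MeasurableSpace (Matrix (Fin N) (Fin N) F)] [BorelSpace (Matrix (Fin N) (Fin N) F)] (μ𝔤 : Measure (Matrix (Fin N) (Fin N) F)) [μ𝔤.IsAddHaarMeasure]
    [MeasurableSpace (GL (Fin N) F)] [BorelSpace (GL (Fin N) F)] (μ₀ : Measure (GL (Fin N) F)) [μ₀.IsHaarMeasure]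
    (r₀ : SmoothIrrep (GL (Fin N) F)) [Module.Finite ℂ r₀.V] (Θ₀ : GL (Fin N) F → ℂ)
    (hloc : ∀ x₀ : GL (Fin N) F, IsRegularElt x₀ → ∀ᶠ y in 𝓝 x₀, Θ₀ y = Θ₀ x₀)
    (hrep : ∀ φ₀ : GL (Fin N) F → ℂ, IsLocSmooth φ₀ → (IrrClass.mk r₀).smoothTrace μ₀ φ₀ = ∫ x, φ₀ x * Θ₀ x ∂μ₀) :
    ∃ V : Set (Matrix (Fin N) (Fin N) F), V ∈ 𝓝 (0 : Matrix (Fin N) (Fin N) F) ∧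
      ∃ T : (Matrix (Fin N) (Fin N) F → ℂ) → ℂ,
        ((∀ f₁ f₂ : Matrix (Fin N) (Fin N) F → ℂ, IsLocSmooth f₁ → IsLocSmooth f₂ → T (f₁ + f₂) = T f₁ + T f₂) ∧
         (∀ (a : ℂ) (f : Matrix (Fin N) (Fin N) F → ℂ), IsLocSmooth f → T (a • f) = a * T f) ∧
         (∀ (x : GL (Fin N) F) (f : Matrix (Fin N) (Fin N) F → ℂ), IsLocSmooth f →
            T (fun X => f ((x : Matrix (Fin N) (Fin N) F) * X * ((x⁻¹ : GL (Fin N) F) : Matrix (Fin N) (Fin N) F))) = T f) ∧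
         (∀ f : Matrix (Fin N) (Fin N) F → ℂ, IsLocSmooth f → (∀ X ∈ tsupport f, ¬ IsNilpotent X) → T f = 0)) ∧
        ∀ Fn : Matrix (Fin N) (Fin N) F → ℂ,
          (∀ f : Matrix (Fin N) (Fin N) F → ℂ, IsLocSmooth f →
              T (fun Y => ∫ X, ((ψ (Matrix.trace (Y * X)) : Circle) : ℂ) * f X ∂μ𝔤) = ∫ X, f X * Fn X ∂μ𝔤) →
          (∀ X : Matrix (Fin N) (Fin N) F, IsUnit X.charpoly.discr → ∀ᶠ Y in 𝓝 X, Fn Y = Fn X) →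
          ∀ g : GL (Fin N) F, ∀ Y ∈ V, IsUnit Y.charpoly.discr → IsUnit (1 - Y) → IsUnit (1 + Y) →
            (g : Matrix (Fin N) (Fin N) F) = (1 + Y) * (1 - Y)⁻¹ → Θ₀ g = Fn Y := by
  classical
  haveI : T2Space F := (isLocalField F).toT2Space
  haveI : LocallyCompactSpace F := (isLocalField F).toLocallyCompactSpace
  haveI : LocallyCompactSpace (Matrix (Fin N) (Fin N) F) := inferInstanceAs (LocallyCompactSpace (Fin N → Fin N → F))
  haveI : LocallyCompactSpace (GL (Fin N) F) := inferInstance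
  haveI : NonarchimedeanGroup (GL (Fin N) F) := nonarchimedeanGroup_gl F N
  -- the dimension, read as the trace of `π(1)`
  set d : ℂ := LinearMap.trace ℂ r₀.V (r₀.ρ 1) with hd
  have hW : {g : GL (Fin N) F | LinearMap.trace ℂ r₀.V (r₀.ρ g) = d} ∈ 𝓝 (1 : GL (Fin N) F) :=
    ((isLocallyConstant_trace r₀.ρ r₀.isSmooth).isOpen_fiber d).mem_nhds rfl
  obtain ⟨V, hV, hVW⟩ := cayley_mem_nhds_one hW
  refine ⟨V, hV, fun f => d * f 0, ⟨fun f₁ f₂ _ _ => by simp only [Pi.add_apply, mul_add], fun a f _ => by simp only [Pi.smul_apply, smul_eq_mul]; ring,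
    fun x f _ => by simp only [mul_zero, zero_mul], fun f _ hnil => ?_⟩, ?_⟩
  · have h0 : (0 : Matrix (Fin N) (Fin N) F) ∉ tsupport f := fun h => hnil 0 h IsNilpotent.zero
    show d * f 0 = 0
    rw [image_eq_zero_of_notMem_tsupport h0, mul_zero]
  · intro Fn hFn hFnloc g Y hYV hdisc h1 h2 hg
    -- `F_T(Y) = dim π`
    have hFnY : Fn Y = d := apply_eq_of_repr_fourier_pointSupport ψ μ𝔤 d Fn (fun f hf => hFn f hf) (hFnloc Y hdisc)
    -- `c(Y)` is regular
    have hgreg : IsRegularElt g := by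
      rw [isRegularElt_iff_isUnit_discr, hg]
      have h := discr_charpoly_cayley_mul_det_pow Y ((Matrix.isUnit_iff_isUnit_det _).1 h1)
      have h2u : IsUnit ((2 : F) ^ (N * (N - 1)) * Y.charpoly.discr) := (isUnit_iff_ne_zero.2 (pow_ne_zero _ two_ne_zero)).mul hdisc
      rw [← h] at h2u
      exact isUnit_of_mul_isUnit_left h2u
    -- `Θ_π(g) = tr π(g) = dim π`
    rw [hFnY, apply_eq_trace_of_finite r₀ μ₀ Θ₀ hrep (hloc g hgreg)]
    exact hVW g Y hYV h1 h2 hg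

/-! ## §4  Rank `N = 1`: every admissible irreducible `π` of `GL₁(F)` is finite-dimensional, so (L-A_GL) holds verbatim -/

/-- **An admissible irreducible smooth representation of the commutative group `GL₁(F)` is finite-dimensional**: for a non-zero vector `v` and a compact open
subgroup `K` of its (open) stabiliser, `V^K ∋ v` is `G`-stable (`G` is commutative), hence a non-zero subrepresentation, hence all of `V`; and `V^K` is
finite-dimensional by admissibility. [cite: BushnellHenniart2006, §2.6] [cite: BernsteinZelevinsky1976, Definition 2.1(b)] -/
theorem finite_of_isAdmissible_gl_one (r : SmoothIrrep (GL (Fin 1) F)) (hadm : r.ρ.IsAdmissible) : Module.Finite ℂ r.V := by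
  classical
  haveI : T2Space F := (isLocalField F).toT2Space
  haveI : LocallyCompactSpace F := (isLocalField F).toLocallyCompactSpace
  haveI : LocallyCompactSpace (Matrix (Fin 1) (Fin 1) F) := inferInstanceAs (LocallyCompactSpace (Fin 1 → Fin 1 → F))
  haveI : LocallyCompactSpace (GL (Fin 1) F) := inferInstance
  haveI : NonarchimedeanGroup (GL (Fin 1) F) := nonarchimedeanGroup_gl F 1
  haveI : r.ρ.IsIrreducible := r.isIrreducible
  -- a non-zero vector (irreducible representations are non-zero)
  have hbt : (⊥ : Subrepresentation r.ρ) ≠ ⊤ := bot_ne_top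
  have hVnt : (⊤ : Submodule ℂ r.V) ≠ ⊥ := by
    intro h
    exact hbt (Subrepresentation.toSubmodule_injective (by
      change (⊥ : Submodule ℂ r.V) = ⊤
      exact h.symm))
  obtain ⟨v, -, hv⟩ := Submodule.exists_mem_ne_zero_of_ne_bot hVnt
  -- a compact open subgroup fixing `v`
  have hst : ((r.ρ.stabilizerSubgroup v : Subgroup (GL (Fin 1) F)) : Set (GL (Fin 1) F)) ∈ 𝓝 (1 : GL (Fin 1) F) :=
    (r.isSmooth v).mem_nhds (Subgroup.one_mem _)
  obtain ⟨K, hKo, hKc, hKst⟩ := exists_isCompact_isOpen_subgroup_subset hst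
  -- `V^K` is a subrepresentation (commutativity), non-zero, hence everything
  let W : Subrepresentation r.ρ :=
    ⟨r.ρ.fixedPoints K, fun g w hw => by
      rw [Representation.mem_fixedPoints] at hw ⊢
      intro k hk
      rw [← Module.End.mul_apply, ← map_mul, K2E3GLTwoRamifiedShellStabilizers.glOne_mul_comm k g, map_mul, Module.End.mul_apply, hw k hk]⟩
  have hvW : v ∈ r.ρ.fixedPoints K := by
    rw [Representation.mem_fixedPoints]
    intro k hk
    exact (r.ρ.mem_stabilizerSubgroup v k).1 (hKst hk)
  have hWtop : W = ⊤ := by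
    rcases IsSimpleOrder.eq_bot_or_eq_top W with h | h
    · exfalso
      have hmem : v ∈ W.toSubmodule := hvW
      rw [h] at hmem
      exact hv ((Submodule.mem_bot ℂ).1 hmem)
    · exact h
  have htop : r.ρ.fixedPoints K = ⊤ := congrArg Subrepresentation.toSubmodule hWtop
  haveI : Module.Finite ℂ (r.ρ.fixedPoints K) := hadm.2 ⟨K, hKo⟩ hKc
  exact Module.Finite.equiv (LinearEquiv.ofTop (r.ρ.fixedPoints K) htop)

set_option maxHeartbeats 1600000 in
/-- **(L-A_GL) «local character expansion at `1` in `T̂`-form» IN RANK `N = 1`** — the socket statement `subsig_K2E3GLnLieCharExpansionAtOne` (SUBSIGS v3 ∕ `hAGL`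
of ★ `normalizedCharBddOnCayleySlice_of_lieCore'`) with `N := 1`, all hypotheses kept: every admissible irreducible `π` of `GL₁(F)` is finite-dimensional
(`finite_of_isAdmissible_gl_one`), so §3 applies with `T = dim π · δ₀`.  With ★ `gl1_nilpotentFourierRegular` (p856457) both `GL`-cores of the row-12 reduction are
★ in rank `1` (count-neutral: the hosted socket quantifies every `N`). [cite: HarishChandra1999AdmissibleDistributions, Thm. 16.3 p. 77, §21 p. 87] [cite: Howe1974, Prop. 3] -/
theorem gl1_lieCharExpansionAtOne :
    ∀ (F : Type) [Field F] [ValuativeRel F] [TopologicalSpace F] [IsNonarchimedeanLocalField F] [CharZero F]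
      (ψ : AddChar F Circle), ψ.IsContinuousNontrivial →
      ∀ [MeasurableSpace (Matrix (Fin 1) (Fin 1) F)] [BorelSpace (Matrix (Fin 1) (Fin 1) F)] (μ𝔤 : Measure (Matrix (Fin 1) (Fin 1) F)) [μ𝔤.IsAddHaarMeasure]
        [MeasurableSpace (GL (Fin 1) F)] [BorelSpace (GL (Fin 1) F)] (μ₀ : Measure (GL (Fin 1) F)) [μ₀.IsHaarMeasure]
        (r₀ : SmoothIrrep (GL (Fin 1) F)), r₀.ρ.IsAdmissible → ∀ Θ₀ : GL (Fin 1) F → ℂ,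
        (∀ x₀ : GL (Fin 1) F, IsRegularElt x₀ → ∀ᶠ y in 𝓝 x₀, Θ₀ y = Θ₀ x₀) →
        (∀ φ₀ : GL (Fin 1) F → ℂ, IsLocSmooth φ₀ → (IrrClass.mk r₀).smoothTrace μ₀ φ₀ = ∫ x, φ₀ x * Θ₀ x ∂μ₀) →
      ∃ V : Set (Matrix (Fin 1) (Fin 1) F), V ∈ 𝓝 (0 : Matrix (Fin 1) (Fin 1) F) ∧
      ∃ T : (Matrix (Fin 1) (Fin 1) F → ℂ) → ℂ,
        ((∀ f₁ f₂ : Matrix (Fin 1) (Fin 1) F → ℂ, IsLocSmooth f₁ → IsLocSmooth f₂ → T (f₁ + f₂) = T f₁ + T f₂) ∧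
         (∀ (a : ℂ) (f : Matrix (Fin 1) (Fin 1) F → ℂ), IsLocSmooth f → T (a • f) = a * T f) ∧
         (∀ (x : GL (Fin 1) F) (f : Matrix (Fin 1) (Fin 1) F → ℂ), IsLocSmooth f →
            T (fun X => f ((x : Matrix (Fin 1) (Fin 1) F) * X * ((x⁻¹ : GL (Fin 1) F) : Matrix (Fin 1) (Fin 1) F))) = T f) ∧
         (∀ f : Matrix (Fin 1) (Fin 1) F → ℂ, IsLocSmooth f → (∀ X ∈ tsupport f, ¬ IsNilpotent X) → T f = 0)) ∧
        ∀ Fn : Matrix (Fin 1) (Fin 1) F → ℂ,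
          (∀ f : Matrix (Fin 1) (Fin 1) F → ℂ, IsLocSmooth f →
              T (fun Y => ∫ X, ((ψ (Matrix.trace (Y * X)) : Circle) : ℂ) * f X ∂μ𝔤) = ∫ X, f X * Fn X ∂μ𝔤) →
          (∀ X : Matrix (Fin 1) (Fin 1) F, IsUnit X.charpoly.discr → ∀ᶠ Y in 𝓝 X, Fn Y = Fn X) →
          ∀ g : GL (Fin 1) F, ∀ Y ∈ V, IsUnit Y.charpoly.discr → IsUnit (1 - Y) → IsUnit (1 + Y) →
            (g : Matrix (Fin 1) (Fin 1) F) = (1 + Y) * (1 - Y)⁻¹ → Θ₀ g = Fn Y := by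
  intro F _ _ _ _ _ ψ _ _ _ μ𝔤 _ _ _ μ₀ _ r₀ hr₀ Θ₀ hloc hrep
  haveI : Module.Finite ℂ r₀.V := finite_of_isAdmissible_gl_one r₀ hr₀
  exact lieCharExpansionAtOne_of_finite ψ μ𝔤 μ₀ r₀ Θ₀ hloc hrep

end Summit.HodgeConjecture.HodgeConjecture.Cruxes.H413.K2E3GLnLieCharExpansionAtOneFinDim

end
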